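import Summits.Ventures.LatticeQCDFlow.Scoring.SU2TorusWilsonLoopContinuumLimit
import Summits.Ventures.LatticeQCDFlow.Scoring.SU2TorusPolyakovLoops
import HarnessLib

/-!
# The continuum limit of the `SU(2)` Polyakov-loop pair correlator on the torus

HONEST FRAMING: exact (Metropolis-corrected) sampling algorithms for lattice gauge theory;
figures of merit are autocorrelation/cost numbers at stated couplings and volumes; no
continuum-physics claim.

Venture `LatticeQCDFlow` (cell pub-lqcd), sub-topic `Scoring`; FANOUT row 5 (`s0-sun-a`), GEN-15.
NEW WORK of the cell (placement rule).  `Scoring/SU2TorusPolyakovLoops.lean` typed the exact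
correlator of two parallel Polyakov loops at separation `T` (`1 ≤ T ≤ L − 1`) of theory-2's `SU(2)`
Wilson measure on `(ℤ/L)²`:
`⟨½tr P_j · ½tr P_{j+T}⟩ = ¼Σ_n[λ_n^{LT}λ_{n+1}^{L²−LT} + λ_{n+1}^{LT}λ_n^{L²−LT}]/Σ_n λ_n^{L²}`,
`λ_n = e^{−2β}I_{n+1}(2β)/β`.  With the normalised terms of
`Scoring/SU2TorusWilsonLoopContinuumLimit.lean` (`ρ_n = I_{n+1}(2β)/I₁(2β)`,
`ρ_n(2β_j)^{A_j} → e^{−a n(n+2)/4}` when `A_j/β_j → a`):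

* `tendsto_tsum_su2_polyakov_terms` — dominated convergence of the normalised numerator;
* **`tendsto_wilson_mean_su2a0_polyakov_pair`** — **THE CONTINUUM LIMIT**: if `β_j → ∞`,
  `1 ≤ T_j`, `T_j + 1 ≤ L_j`, `L_jT_j/β_j → a` and `L_j²/β_j → v > 0` (the two loops cut the torus of
  area `v` into cylinders of areas `a` and `v − a`), then
  `⟨½tr P · ½tr P'⟩_{L_j,β_j} → ¼Σ_n[e^{−a n(n+2)/4} e^{−(v−a)(n+1)(n+3)/4} + e^{−a(n+1)(n+3)/4} e^{−(v−a)n(n+2)/4}] / Σ_n e^{−v n(n+2)/4}`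
  — the genus-one two-cylinder gluing formula as an honest limit of the lattice model.

Elementary given the parents; nothing is cited.  No sampler values.
-/

noncomputable section

open Real Filter Topology Set MeasureTheory
open scoped ENNReal
open Literature.Analysis.FunctionSpaces
open Literature.MathematicalPhysics.QuantumFieldTheory
open Literature.MathematicalPhysics.QuantumLattice
open Summit.Ventures.LatticeQCDFlow.Exactness Summit.Ventures.LatticeQCDFlow.Theory2.Lattice

namespace Summit.Ventures.LatticeQCDFlow.Scoring

/-! ### 1. The normalised terms -/

/-- The normalised Polyakov-pair term: with `λ_n = e^{−2β} I_{n+1}(2β)/β`, `ρ_n = I_{n+1}(2β)/I₁(2β)`,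
`A ≤ V`: `λ_n^{A}λ_{n+1}^{V−A} + λ_{n+1}^{A}λ_n^{V−A} = λ_0^V (ρ_n^{A}ρ_{n+1}^{V−A} + ρ_{n+1}^{A}ρ_n^{V−A})`. -/
theorem su2_polyakov_term_eq {β : ℝ} (hβ : 0 < β) {A V : ℕ} (hAV : A ≤ V) (n : ℕ) :
    (Real.exp (-(2 * β)) * besselI (n + 1) (2 * β) / β) ^ A *
        (Real.exp (-(2 * β)) * besselI (n + 2) (2 * β) / β) ^ (V - A) +
      (Real.exp (-(2 * β)) * besselI (n + 2) (2 * β) / β) ^ A *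
        (Real.exp (-(2 * β)) * besselI (n + 1) (2 * β) / β) ^ (V - A) =
      (Real.exp (-(2 * β)) * besselI 1 (2 * β) / β) ^ V *
        ((besselI (n + 1) (2 * β) / besselI 1 (2 * β)) ^ A *
            (besselI (n + 2) (2 * β) / besselI 1 (2 * β)) ^ (V - A) +
          (besselI (n + 2) (2 * β) / besselI 1 (2 * β)) ^ A *
            (besselI (n + 1) (2 * β) / besselI 1 (2 * β)) ^ (V - A)) := by
  have hI1 : 0 < besselI 1 (2 * β) := besselI_pos 1 (by linarith)
  set l0 := Real.exp (-(2 * β)) * besselI 1 (2 * β) / β with hl0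
  have hl : ∀ m : ℕ, Real.exp (-(2 * β)) * besselI m (2 * β) / β = l0 * (besselI m (2 * β) / besselI 1 (2 * β)) := by
    intro m; rw [hl0]; field_simp
  rw [hl (n + 1), hl (n + 2), mul_pow, mul_pow, mul_pow, mul_pow]
  have hV : l0 ^ V = l0 ^ A * l0 ^ (V - A) := by rw [← pow_add, Nat.add_sub_cancel' hAV]
  rw [hV]
  ring

/-- **Numerator**: if `β_j → ∞`, `A_j ≤ V_j`, `A_j/β_j → a`, `V_j/β_j → v > 0`, then
`Σ_n ¼[ρ_n^{A_j}ρ_{n+1}^{V_j−A_j} + ρ_{n+1}^{A_j}ρ_n^{V_j−A_j}]` converges to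
`Σ_n ¼[e^{−a n(n+2)/4} e^{−(v−a)(n+1)(n+3)/4} + e^{−a(n+1)(n+3)/4} e^{−(v−a)n(n+2)/4}]`. -/
theorem tendsto_tsum_su2_polyakov_terms {β : ℕ → ℝ} {A V : ℕ → ℕ} {a v : ℝ} (hv0 : 0 < v)
    (hβ : Tendsto β atTop atTop) (hAV : ∀ j, A j ≤ V j)
    (ha : Tendsto (fun j => (A j : ℝ) / β j) atTop (𝓝 a))
    (hv : Tendsto (fun j => (V j : ℝ) / β j) atTop (𝓝 v)) :
    Tendsto (fun j => ∑' n : ℕ, (1 / 4 : ℝ) *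
        ((besselI (n + 1) (2 * β j) / besselI 1 (2 * β j)) ^ A j *
            (besselI (n + 2) (2 * β j) / besselI 1 (2 * β j)) ^ (V j - A j) +
          (besselI (n + 2) (2 * β j) / besselI 1 (2 * β j)) ^ A j *
            (besselI (n + 1) (2 * β j) / besselI 1 (2 * β j)) ^ (V j - A j)))
      atTop (𝓝 (∑' n : ℕ, (1 / 4 : ℝ) *
        (Real.exp (-(a * (n : ℝ) * (n + 2) / 4)) * Real.exp (-((v - a) * ((n : ℝ) + 1) * (n + 3) / 4)) +
          Real.exp (-(a * ((n : ℝ) + 1) * (n + 3) / 4)) * Real.exp (-((v - a) * (n : ℝ) * (n + 2) / 4))))) := by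
  have hx : Tendsto (fun j => 2 * β j) atTop atTop := hβ.const_mul_atTop (by norm_num)
  have hax : Tendsto (fun j => (A j : ℝ) / (2 * β j)) atTop (𝓝 (a / 2)) := by
    refine (ha.div_const 2).congr fun j => ?_
    rw [div_div, mul_comm]
  have hvx : Tendsto (fun j => (V j : ℝ) / (2 * β j)) atTop (𝓝 (v / 2)) := by
    refine (hv.div_const 2).congr fun j => ?_
    rw [div_div, mul_comm]
  have hdx : Tendsto (fun j => ((V j - A j : ℕ) : ℝ) / (2 * β j)) atTop (𝓝 ((v - a) / 2)) := by
    have := (hvx.sub hax)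
    rw [show v / 2 - a / 2 = (v - a) / 2 by ring] at this
    refine this.congr fun j => ?_
    rw [Nat.cast_sub (hAV j), sub_div]
  have hlim : ∀ n : ℕ, Tendsto (fun j => (1 / 4 : ℝ) *
      ((besselI (n + 1) (2 * β j) / besselI 1 (2 * β j)) ^ A j *
          (besselI (n + 2) (2 * β j) / besselI 1 (2 * β j)) ^ (V j - A j) +
        (besselI (n + 2) (2 * β j) / besselI 1 (2 * β j)) ^ A j *
          (besselI (n + 1) (2 * β j) / besselI 1 (2 * β j)) ^ (V j - A j)))
      atTop (𝓝 ((1 / 4 : ℝ) *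
        (Real.exp (-(a * (n : ℝ) * (n + 2) / 4)) * Real.exp (-((v - a) * ((n : ℝ) + 1) * (n + 3) / 4)) +
          Real.exp (-(a * ((n : ℝ) + 1) * (n + 3) / 4)) * Real.exp (-((v - a) * (n : ℝ) * (n + 2) / 4))))) := by
    intro n
    have h1 := tendsto_besselI_succ_ratio_pow_of hx hax n
    have h2 := tendsto_besselI_succ_ratio_pow_of hx hdx (n + 1)
    have h3 := tendsto_besselI_succ_ratio_pow_of hx hax (n + 1)
    have h4 := tendsto_besselI_succ_ratio_pow_of hx hdx n
    have e1 : a / 2 * ((n : ℝ) * (n + 2) / 2) = a * (n : ℝ) * (n + 2) / 4 := by ring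
    have e2 : (v - a) / 2 * (((n + 1 : ℕ) : ℝ) * (((n + 1 : ℕ) : ℝ) + 2) / 2) =
        (v - a) * ((n : ℝ) + 1) * (n + 3) / 4 := by push_cast; ring
    have e3 : a / 2 * (((n + 1 : ℕ) : ℝ) * (((n + 1 : ℕ) : ℝ) + 2) / 2) = a * ((n : ℝ) + 1) * (n + 3) / 4 := by
      push_cast; ring
    have e4 : (v - a) / 2 * ((n : ℝ) * (n + 2) / 2) = (v - a) * (n : ℝ) * (n + 2) / 4 := by ring
    rw [e1] at h1
    rw [e2] at h2
    rw [e3] at h3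
    rw [e4] at h4
    exact ((h1.mul h2).add (h3.mul h4)).const_mul (1 / 4)
  have hv2 : 0 < v / 2 := by positivity
  set c := min (v / 2 / 2 / 4) (1 / 2) with hc
  have hc0 : 0 < c := lt_min (by positivity) (by norm_num)
  refine tendsto_tsum_of_dominated_convergence
    (bound := fun n : ℕ => 1 / 2 * (Real.exp (2 * (v / 2)) * Real.exp (-(c * n)))) ?_ hlim ?_
  · exact ((summable_exp_neg_mul_nat hc0).mul_left _).mul_left _
  · filter_upwards [eventually_continuumLimit_bounds hv2 hx hvx] with j hj n
    obtain ⟨hj0, hlo, hhi, h2⟩ := hj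
    have hI1 : 0 < besselI 1 (2 * β j) := besselI_pos 1 hj0
    set ρ : ℕ → ℝ := fun m => besselI (m + 1) (2 * β j) / besselI 1 (2 * β j) with hρ
    have hρ0 : ∀ m, 0 ≤ ρ m := fun m => div_nonneg (besselI_pos _ hj0).le hI1.le
    have hρmono : ρ (n + 1) ≤ ρ n :=
      div_le_div_of_nonneg_right (besselI_succ_le (n + 1) (by linarith)) hI1.le
    have hpow := besselI_ratio_one_pow_le hj0 (by positivity) hlo hhi h2 n
    have hAVj := hAV j
    have hP1 : ρ n ^ A j * ρ (n + 1) ^ (V j - A j) ≤ ρ n ^ V j := by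
      calc ρ n ^ A j * ρ (n + 1) ^ (V j - A j) ≤ ρ n ^ A j * ρ n ^ (V j - A j) :=
            mul_le_mul_of_nonneg_left (pow_le_pow_left₀ (hρ0 _) hρmono _) (pow_nonneg (hρ0 _) _)
        _ = ρ n ^ V j := by rw [← pow_add, Nat.add_sub_cancel' hAVj]
    have hP2 : ρ (n + 1) ^ A j * ρ n ^ (V j - A j) ≤ ρ n ^ V j := by
      calc ρ (n + 1) ^ A j * ρ n ^ (V j - A j) ≤ ρ n ^ A j * ρ n ^ (V j - A j) :=
            mul_le_mul_of_nonneg_right (pow_le_pow_left₀ (hρ0 _) hρmono _) (pow_nonneg (hρ0 _) _)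
        _ = ρ n ^ V j := by rw [← pow_add, Nat.add_sub_cancel' hAVj]
    have hT0 : 0 ≤ (1 / 4 : ℝ) * (ρ n ^ A j * ρ (n + 1) ^ (V j - A j) + ρ (n + 1) ^ A j * ρ n ^ (V j - A j)) :=
      mul_nonneg (by norm_num) (add_nonneg (mul_nonneg (pow_nonneg (hρ0 _) _) (pow_nonneg (hρ0 _) _))
        (mul_nonneg (pow_nonneg (hρ0 _) _) (pow_nonneg (hρ0 _) _)))
    simp only [hρ] at hT0 hP1 hP2 hpow ⊢
    rw [Real.norm_of_nonneg hT0]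
    nlinarith [hP1, hP2, hpow]

/-! ### 2. The continuum limit of the correlator -/

variable {Ls : ℕ → ℕ} [hNZ : ∀ j, NeZero (Ls j)]

/-- **THE CONTINUUM LIMIT OF THE `SU(2)` POLYAKOV-LOOP PAIR CORRELATOR ON THE TORUS.**  If `β_j → ∞`,
`1 ≤ T_j`, `T_j + 1 ≤ L_j`, `L_jT_j/β_j → a` and `L_j²/β_j → v > 0`, then
`⟨½tr P_0 · ½tr P_{T_j}⟩_{L_j,β_j} → ¼Σ_n[e^{−a n(n+2)/4}e^{−(v−a)(n+1)(n+3)/4} + e^{−a(n+1)(n+3)/4}e^{−(v−a)n(n+2)/4}]/Σ_n e^{−v n(n+2)/4}`. -/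
theorem tendsto_wilson_mean_su2a0_polyakov_pair {β : ℕ → ℝ} {T : ℕ → ℕ} {a v : ℝ} (hv0 : 0 < v)
    (hβ : Tendsto β atTop atTop) (hT : ∀ j, 1 ≤ T j) (hTL : ∀ j, T j + 1 ≤ Ls j)
    (ha : Tendsto (fun j => ((Ls j * T j : ℕ) : ℝ) / β j) atTop (𝓝 a))
    (hv : Tendsto (fun j => ((Ls j ^ 2 : ℕ) : ℝ) / β j) atTop (𝓝 v)) :
    Tendsto (fun j => ∫ U, su2a0 (((List.range (Ls j)).map fun x : ℕ => U (![(0 : ZMod (Ls j)) + x, 0], 0)).prod) *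
          su2a0 (((List.range (Ls j)).map fun x : ℕ => U (![(0 : ZMod (Ls j)) + x, 0 + T j], 0)).prod)
        ∂(wilsonMeasure (d := 2) (L := Ls j) (fundamentalRep (Fin 2)) (β j))) atTop
      (𝓝 ((∑' n : ℕ, (1 / 4 : ℝ) *
        (Real.exp (-(a * (n : ℝ) * (n + 2) / 4)) * Real.exp (-((v - a) * ((n : ℝ) + 1) * (n + 3) / 4)) +
          Real.exp (-(a * ((n : ℝ) + 1) * (n + 3) / 4)) * Real.exp (-((v - a) * (n : ℝ) * (n + 2) / 4)))) /
        ∑' n : ℕ, Real.exp (-(v * (n : ℝ) * (n + 2) / 4)))) := by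
  have hAV : ∀ j, Ls j * T j ≤ Ls j ^ 2 := fun j => by
    rw [sq]; exact Nat.mul_le_mul_left _ (by have := hTL j; omega)
  have hnum := tendsto_tsum_su2_polyakov_terms hv0 hβ hAV ha hv
  have hden := tendsto_tsum_besselI_succ_ratio_pow hv0 hβ hv
  have hDpos : 0 < ∑' n : ℕ, Real.exp (-(v * (n : ℝ) * (n + 2) / 4)) := by
    have hsum : Summable fun n : ℕ => Real.exp (-(v * (n : ℝ) * (n + 2) / 4)) := by
      refine Summable.of_nonneg_of_le (fun n => (Real.exp_pos _).le) (fun n => ?_)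
        (summable_exp_neg_mul_nat (by positivity : 0 < v / 2))
      refine Real.exp_le_exp.2 ?_
      have : (0 : ℝ) ≤ n := by positivity
      nlinarith [mul_nonneg hv0.le (mul_self_nonneg (n : ℝ))]
    exact hsum.tsum_pos (fun n => (Real.exp_pos _).le) 0 (Real.exp_pos _)
  refine (hnum.div hden hDpos.ne').congr' ?_
  filter_upwards [hβ.eventually_gt_atTop 0] with j hj
  simp only [Pi.div_apply]
  rw [wilson_mean_su2a0_polyakov_pair_two hj.le (0 : ZMod (Ls j)) 0 (hT j) (hTL j)]
  have hI1ne : besselI 1 (2 * β j) ≠ 0 := (besselI_pos 1 (by linarith : (0 : ℝ) < 2 * β j)).ne'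
  have hl0 : 0 < Real.exp (-(2 * β j)) * besselI 1 (2 * β j) / β j := by
    have := besselI_pos 1 (by linarith : (0 : ℝ) < 2 * β j); positivity
  simp_rw [su2_charTerm_eq hj.ne', su2_charTerm_succ_eq hj.ne']
  have hN : ∀ n : ℕ, (1 / 4 : ℝ) *
      ((Real.exp (-(2 * β j)) * besselI (n + 1) (2 * β j) / β j) ^ (Ls j * T j) *
          (Real.exp (-(2 * β j)) * besselI (n + 2) (2 * β j) / β j) ^ (Ls j ^ 2 - Ls j * T j) +
        (Real.exp (-(2 * β j)) * besselI (n + 2) (2 * β j) / β j) ^ (Ls j * T j) *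
          (Real.exp (-(2 * β j)) * besselI (n + 1) (2 * β j) / β j) ^ (Ls j ^ 2 - Ls j * T j)) =
      (Real.exp (-(2 * β j)) * besselI 1 (2 * β j) / β j) ^ (Ls j ^ 2) * ((1 / 4 : ℝ) *
        ((besselI (n + 1) (2 * β j) / besselI 1 (2 * β j)) ^ (Ls j * T j) *
            (besselI (n + 2) (2 * β j) / besselI 1 (2 * β j)) ^ (Ls j ^ 2 - Ls j * T j) +
          (besselI (n + 2) (2 * β j) / besselI 1 (2 * β j)) ^ (Ls j * T j) *
            (besselI (n + 1) (2 * β j) / besselI 1 (2 * β j)) ^ (Ls j ^ 2 - Ls j * T j))) := by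
    intro n
    rw [su2_polyakov_term_eq hj (hAV j) n]
    ring
  have hD : ∀ n : ℕ, (Real.exp (-(2 * β j)) * besselI (n + 1) (2 * β j) / β j) ^ (Ls j ^ 2) =
      (Real.exp (-(2 * β j)) * besselI 1 (2 * β j) / β j) ^ (Ls j ^ 2) *
        (besselI (n + 1) (2 * β j) / besselI 1 (2 * β j)) ^ (Ls j ^ 2) := by
    intro n
    rw [← mul_pow]
    congr 1
    field_simp
  have hNum : (∑' n : ℕ, (1 / 4 : ℝ) *
      ((Real.exp (-(2 * β j)) * besselI (n + 1) (2 * β j) / β j) ^ (Ls j * T j) *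
          (Real.exp (-(2 * β j)) * besselI (n + 2) (2 * β j) / β j) ^ (Ls j ^ 2 - Ls j * T j) +
        (Real.exp (-(2 * β j)) * besselI (n + 2) (2 * β j) / β j) ^ (Ls j * T j) *
          (Real.exp (-(2 * β j)) * besselI (n + 1) (2 * β j) / β j) ^ (Ls j ^ 2 - Ls j * T j))) =
      (Real.exp (-(2 * β j)) * besselI 1 (2 * β j) / β j) ^ (Ls j ^ 2) * ∑' n : ℕ, (1 / 4 : ℝ) *
        ((besselI (n + 1) (2 * β j) / besselI 1 (2 * β j)) ^ (Ls j * T j) *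
            (besselI (n + 2) (2 * β j) / besselI 1 (2 * β j)) ^ (Ls j ^ 2 - Ls j * T j) +
          (besselI (n + 2) (2 * β j) / besselI 1 (2 * β j)) ^ (Ls j * T j) *
            (besselI (n + 1) (2 * β j) / besselI 1 (2 * β j)) ^ (Ls j ^ 2 - Ls j * T j)) := by
    rw [← tsum_mul_left]; exact tsum_congr hN
  have hDen : (∑' n : ℕ, (Real.exp (-(2 * β j)) * besselI (n + 1) (2 * β j) / β j) ^ (Ls j ^ 2)) =
      (Real.exp (-(2 * β j)) * besselI 1 (2 * β j) / β j) ^ (Ls j ^ 2) *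
        ∑' n : ℕ, (besselI (n + 1) (2 * β j) / besselI 1 (2 * β j)) ^ (Ls j ^ 2) := by
    rw [← tsum_mul_left]; exact tsum_congr hD
  rw [hNum, hDen, mul_div_mul_left _ _ (pow_ne_zero _ hl0.ne')]

end Summit.Ventures.LatticeQCDFlow.Scoring
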